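import Summits.HodgeConjecture.HodgeConjecture.Theorems.F0P3SpectralPacketXiEvp   -- ★ (N) FILE 3s (this seat): (P2a) read-backs (+ ★ 3q `piXiS`, ★ 3r `rhoXiS`, ★ 3f `evpGψ`∕`trSψ`, ★ 3h `evpHψ`∕`trHSψ`, ★ 3a `SpectralPacketG.n`)
import HarnessLib

/-!
# (N) DEFS, FILE 3t — (P2b) AT THE TUPLE: THE TWO GERM SUMS OF `APacketSpectral` FROM RIGIDITY AND THE MULTIPLICITY VALUES
# (Rogawski §13.3 Thm. 13.3.5 p. 202 (rigidity), Thm. 13.3.7 pp. 202–203, p. 203 «`Card(Π̂)`»; §14.6 (14.6.2) p. 241 «`Π` is unique», (14.6.3) p. 243 «there exists a unique `ξ` …»)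

Cell `hodgecm-mathlib` (D-0151), F0∕P3 «U3-mult», crux H413 (`stmt-HodgeConjecture-24833`), route of record `HCCMUnconditional`.  (N) lead pen F0P3a-p01 (g13); BOARD rev. 4
eb9b3ecc §B3′; bus 11:28Z census line; LEAD F0P3a-plan (g10).  Definition lane (two `Prop`-predicates with explicit header binders = the NAMED rigidity laws) + proof-lane theorems;
box-before-file (B-typ03); `--supports stmt-HodgeConjecture-24833 --as helper`.  No instance, no notation, no named fact, no `sorry`.
HONEST LABEL: HC_CM is proved only modulo the printed citations until rung 0 closes; this file proves no printed statement — it NAMES the two rigidity laws that letter PK-A's germ sums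
consume ((L1) `XiRigidityG`, (L3) `XiRigidityH`, print-true: Thm. 13.3.5 + (14.6.2)∕(14.6.3)) and DERIVES the two germ-sum conjuncts of (P2) `APacketSpectral` at the tuple from them,
the multiplicity VALUES `nG (PiXi ξ) = ½`, `nH (ρXi ξ) = 1` [Thm. 13.3.7; p. 203; (14.6.3)] (hypotheses `hnG`, `hnH`), and the (P2a) consistency (★ FILE 3s, entering as hypotheses
`hevpG`∕`hramG`, `hevpH`∕`hramH` so that this file is record-agnostic).

THE MATHEMATICS [(14.6.2)–(14.6.3)].  The `G`-sum of (P2) runs over the discrete packets `Q` with `t(Q) = t(ξ)` off `S` and `ramG Q ⊆ S`; by RIGIDITY (Thm. 13.3.5; p. 241 «`Π` is unique»)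
that index type is `{Π(ξ)}` — a `Unique` subtype once (P2a) puts `Π(ξ)` in it — so the `tsum` is the single term `n(Π(ξ)) · Tr Π(ξ)_S = ½ · Tr Π(ξ)_S` [`Card(Π̂(ξ)) = 2`, p. 203;
(14.6.3)].  The `H`-sum likewise collapses to `n(ξ) · Tr ξ_S = Tr ξ_S` [p. 243 «there exists a unique `ξ` such that the e.v.p.'s `t(Π′)` and `t(Π(ξ))` coincide»; `n(ξ) = 1`].

CONTENTS.
* §1 (L1) **`SpectralPacketG.XiRigidityG h ψ νG tXi : Prop`**, (L3) **`SpectralPacketH.XiRigidityH hH ψ νG tXi : Prop`** — the named laws.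
* §2 (t1) `SpectralPacketG.germSubtype_val_eq_piXiS` (the `G`-index type is `{Π(ξ)}`), (t2) **`SpectralPacketG.tsum_germ_eq_half_mul_piXiS`** — the `G`-germ sum of (P2);
  (t3)∕(t4) the `H`-twins `SpectralPacketH.germSubtype_val_eq_rhoXiS`, **`SpectralPacketH.tsum_germ_eq_rhoXiS`**.

References: [Rogawski1990] §13.3 Thm. 13.3.5 p. 202, Thm. 13.3.7 pp. 202–203, p. 203; §14.6 (14.6.2) p. 241, (14.6.3) p. 243; §13.7 p. 206.
-/

set_option autoImplicit false
-- the mandated namespace repeats `HodgeConjecture.HodgeConjecture`, as in every `Theorems/*.lean` of this sub-problem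
set_option linter.dupNamespace false

noncomputable section

open NumberField IsDedekindDomain MeasureTheory Filter
open scoped Matrix MatrixGroups

open Literature.NumberTheory Literature.NumberTheory.Automorphic Literature.NumberTheory.Automorphic.UnitaryGroup
open Literature.NumberTheory.Rogawski1990 Literature.NumberTheory.GaloisRepresentations
open Literature.RepresentationTheory.BorelWallach2000 Literature.RepresentationTheory.KonnoKonno2007
open Summit.HodgeConjecture.HodgeConjecture.Cruxes.H413.F0P3InnerFormClassificationV6 (TestG splitForm EvpData EqOff germ germ_eq_germ_iff)
open Summit.HodgeConjecture.HodgeConjecture.Cruxes.H413.F0P3LocalPacketKit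
open Summit.HodgeConjecture.HodgeConjecture.Cruxes.H413.F0P3ArchPacketKit
open Summit.HodgeConjecture.HodgeConjecture.Cruxes.H413.F0P3SemilocalTestFunctionsOfRecord (TestS₀)

/-! ## §1 (L1) Rigidity on the `G`-side and (t1)–(t2) the `G`-germ sum [Thm. 13.3.5; (14.6.2); Thm. 13.3.7] -/

namespace Summit.HodgeConjecture.HodgeConjecture.Cruxes.H413.F0P3SpectralPacket.SpectralPacketG

open Summit.HodgeConjecture.HodgeConjecture.Cruxes.H413.F0P3GlobalPacket

variable {L : Type} [Field L] [NumberField L] [IsCMField L] {H : Matrix (Fin 3) (Fin 3) L} {ι : L →+* ℂ} {T : GL (Fin 3) ℂ}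
  {hT : (T : Matrix (Fin 3) (Fin 3) ℂ)ᴴ * H.map ι * (T : Matrix (Fin 3) (Fin 3) ℂ) = Literature.Geometry.ComplexHyperbolic.BallModel.J}
  {𝔩 : ∀ v : HeightOneSpectrum (𝓞 ↥(maximalRealSubfield L)), LocalPacketKit L (splitForm L 3) v} {𝔞 : ArchPacketKit}
  {μ : Measure (adelicGroupData (↥(maximalRealSubfield L)) L (IsCMField.complexConj L) 3 (splitForm L 3)).automorphicQuotient}
  [SMulInvariantMeasure (adelicGroupData (↥(maximalRealSubfield L)) L (IsCMField.complexConj L) 3 (splitForm L 3)).Adelic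
    (adelicGroupData (↥(maximalRealSubfield L)) L (IsCMField.complexConj L) 3 (splitForm L 3)).automorphicQuotient μ]
  {Pk : OneDimAutRepH L → ∀ v : HeightOneSpectrum (𝓞 ↥(maximalRealSubfield L)), CMLocalAPacket L (splitForm L 3) v}
  {PkInf : OneDimAutRepH L → LocalAPacket (GKIrrClass (uFormGroup (Fin 2) (Fin 1)))} {κ : OneDimAutRepH L → ℤ}

/-- **(L1) `XiRigidityG h ψ νG tXi` — RIGIDITY FOR THE A-PACKETS `Π(ξ)` (named law)**: a discrete `G`-packet `Q` whose e.v.p. slot `evpG Q = Q.evpGψ ψ νG` (★ FILE 3f) agrees with the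
record `t(ξ)` off a finite `S` containing `ramG Q` IS `Π(ξ) = piXiS h ξ` — «`t_{S′}` is of the form `t_{S′}(π)` … iff `t_{S′} = t_{S′}(Π)` for some `Π ∈ Π(G)`; furthermore `Π` is unique
by Theorem 13.3.5» [(14.6.2) p. 241] and «there exists a unique `ξ` such that the e.v.p.'s `t(Π′)` and `t(Π(ξ))` coincide» [p. 243].  A hypothesis of the junction (letter PK-A content);
in the `ι`-token kit model it also pins `Q.inf` (print: Thm. 13.3.5 is about full packets). [cite: Rogawski1990, §13.3 Thm. 13.3.5 p. 202; §14.6 (14.6.2) p. 241, (14.6.3) p. 243] -/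
def XiRigidityG (h : XiPacketsSigned 𝔩 𝔞 μ Pk PkInf κ)
    (ψ : ∀ v : HeightOneSpectrum (𝓞 ↥(maximalRealSubfield L)), (cmDatum L 3 H).Local v ≃ₜ* (cmDatum L 3 (splitForm L 3)).Local v)
    [∀ v : HeightOneSpectrum (𝓞 ↥(maximalRealSubfield L)), MeasurableSpace ((cmDatum L 3 (splitForm L 3)).Local v)]
    (νG : ∀ v : HeightOneSpectrum (𝓞 ↥(maximalRealSubfield L)), Measure ((cmDatum L 3 (splitForm L 3)).Local v))
    (tXi : OneDimAutRepH L → EvpData L H) : Prop :=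
  ∀ (ξ : OneDimAutRepH L) (S : Finset (HeightOneSpectrum (𝓞 ↥(maximalRealSubfield L)))) (Q : SpectralPacketG 𝔩 𝔞 μ),
    EqOff L H S (Q.evpGψ ψ νG) (tXi ξ) → Q.fin.ramFinset ⊆ S → Q = piXiS h ξ

variable {h : XiPacketsSigned 𝔩 𝔞 μ Pk PkInf κ}
  {ψ : ∀ v : HeightOneSpectrum (𝓞 ↥(maximalRealSubfield L)), (cmDatum L 3 H).Local v ≃ₜ* (cmDatum L 3 (splitForm L 3)).Local v}
  [∀ v : HeightOneSpectrum (𝓞 ↥(maximalRealSubfield L)), MeasurableSpace ((cmDatum L 3 (splitForm L 3)).Local v)]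
  {νG : ∀ v : HeightOneSpectrum (𝓞 ↥(maximalRealSubfield L)), Measure ((cmDatum L 3 (splitForm L 3)).Local v)}
  {tXi : OneDimAutRepH L → EvpData L H}

/-- **(t1) THE `G`-INDEX TYPE OF (P2) IS `Π(ξ)` ALONE**: under (L1), every element of the subtype `{Q // germ S (evpG Q) = germ S (t ξ) ∧ ramG Q ⊆ S}` has first component `piXiS h ξ`
(and the (P2a) facts put `Π(ξ)` in it). [cite: Rogawski1990, §13.3 Thm. 13.3.5 p. 202; §14.6 (14.6.2) p. 241] -/
theorem germSubtype_val_eq_piXiS (hrig : XiRigidityG h ψ νG tXi) (ξ : OneDimAutRepH L) (S : Finset (HeightOneSpectrum (𝓞 ↥(maximalRealSubfield L))))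
    (Q : {Q : SpectralPacketG 𝔩 𝔞 μ // germ L H S (Q.evpGψ ψ νG) = germ L H S (tXi ξ) ∧ Q.fin.ramFinset ⊆ S}) : Q.1 = piXiS h ξ :=
  hrig ξ S Q.1 ((germ_eq_germ_iff L H S _ _).1 Q.2.1) Q.2.2

/-- **(t2) THE `G`-GERM SUM OF (P2) AT THE TUPLE — «`Σ_{Q : t(Q) = t(ξ) off S, ramG Q ⊆ S} n(Q) · Tr Q_S(f′_S) = ½ · Tr Π(ξ)_S(f′_S)`»** [(14.6.2)–(14.6.3)]: under (L1) rigidity, the (P2a)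
facts for `Π(ξ)` and the multiplicity value `n(Π(ξ)) = ½` [Thm. 13.3.7; `Card(Π̂(ξ)) = 2`, p. 203], for ANY slots `nG`, `trGS` with `nG (piXiS h ξ) = ½`.
[cite: Rogawski1990, §14.6 (14.6.2) p. 241, (14.6.3) p. 243; §13.3 Thm. 13.3.5, Thm. 13.3.7 pp. 202–203] -/
theorem tsum_germ_eq_half_mul_piXiS (hrig : XiRigidityG h ψ νG tXi) (ξ : OneDimAutRepH L) (S : Finset (HeightOneSpectrum (𝓞 ↥(maximalRealSubfield L))))
    (hevpG : EqOff L H S ((piXiS h ξ).evpGψ ψ νG) (tXi ξ)) (hramG : (piXiS h ξ).fin.ramFinset ⊆ S)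
    (nG : SpectralPacketG 𝔩 𝔞 μ → ℂ) (hnG : nG (piXiS h ξ) = 1 / 2) {X : Type} (trGS : SpectralPacketG 𝔩 𝔞 μ → X → ℂ) (fSG : X) :
    (∑' Q : {Q : SpectralPacketG 𝔩 𝔞 μ // germ L H S (Q.evpGψ ψ νG) = germ L H S (tXi ξ) ∧ Q.fin.ramFinset ⊆ S}, nG Q.1 * trGS Q.1 fSG)
      = (1 / 2 : ℂ) * trGS (piXiS h ξ) fSG := by
  let a : {Q : SpectralPacketG 𝔩 𝔞 μ // germ L H S (Q.evpGψ ψ νG) = germ L H S (tXi ξ) ∧ Q.fin.ramFinset ⊆ S} :=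
    ⟨piXiS h ξ, (germ_eq_germ_iff L H S _ _).2 hevpG, hramG⟩
  rw [tsum_eq_single a (fun Q hQ => absurd (Subtype.ext ((germSubtype_val_eq_piXiS hrig ξ S Q).trans (germSubtype_val_eq_piXiS hrig ξ S a).symm)) hQ)]
  change nG (piXiS h ξ) * trGS (piXiS h ξ) fSG = _
  rw [hnG]

end Summit.HodgeConjecture.HodgeConjecture.Cruxes.H413.F0P3SpectralPacket.SpectralPacketG

/-! ## §1′ (L3) Rigidity on the `H`-side and (t3)–(t4) the `H`-germ sum [Thm. 13.3.5; (14.6.2)–(14.6.3)] -/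

namespace Summit.HodgeConjecture.HodgeConjecture.Cruxes.H413.F0P3SpectralPacket.SpectralPacketH

open Summit.HodgeConjecture.HodgeConjecture.Cruxes.H413.F0P3GlobalPacket

variable {L : Type} [Field L] [NumberField L] [IsCMField L] {H : Matrix (Fin 3) (Fin 3) L}
  {𝔩 : ∀ v : HeightOneSpectrum (𝓞 ↥(maximalRealSubfield L)), LocalPacketKit L (splitForm L 3) v} {𝔞 : ArchPacketKit} {𝔞H : ArchPacketKitH 𝔞}
  {DiscH : GlobalPacketH 𝔩 → 𝔞H.PktInfH → Prop}
  {Pk : OneDimAutRepH L → ∀ v : HeightOneSpectrum (𝓞 ↥(maximalRealSubfield L)), CMLocalAPacket L (splitForm L 3) v}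
  {PkInf : OneDimAutRepH L → LocalAPacket (GKIrrClass (uFormGroup (Fin 2) (Fin 1)))}
  {χ : OneDimAutRepH L → ∀ v : HeightOneSpectrum (𝓞 ↥(maximalRealSubfield L)),
    (UnitaryGroup.cmDatum L 2 (Matrix.of fun i j : Fin 2 => if i.val + j.val + 1 = 2 then (1 : L) else 0)).Local v ×
      (UnitaryGroup.cmDatum L 1 (Matrix.of fun i j : Fin 1 => if i.val + j.val + 1 = 1 then (1 : L) else 0)).Local v →* ℂˣ}
  {hχ : ∀ (ξ : OneDimAutRepH L) (v : HeightOneSpectrum (𝓞 ↥(maximalRealSubfield L))),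
    IsOpen (((χ ξ v).ker : Subgroup ((UnitaryGroup.cmDatum L 2 (Matrix.of fun i j : Fin 2 => if i.val + j.val + 1 = 2 then (1 : L) else 0)).Local v ×
      (UnitaryGroup.cmDatum L 1 (Matrix.of fun i j : Fin 1 => if i.val + j.val + 1 = 1 then (1 : L) else 0)).Local v)) :
      Set ((UnitaryGroup.cmDatum L 2 (Matrix.of fun i j : Fin 2 => if i.val + j.val + 1 = 2 then (1 : L) else 0)).Local v ×
        (UnitaryGroup.cmDatum L 1 (Matrix.of fun i j : Fin 1 => if i.val + j.val + 1 = 1 then (1 : L) else 0)).Local v))}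
  {ε : OneDimAutRepH L → HeightOneSpectrum (𝓞 ↥(maximalRealSubfield L)) → ℤ} {κH : OneDimAutRepH L → ℤ}

/-- **(L3) `XiRigidityH hH ψ νG tXi` — RIGIDITY FOR `ξ` AS AN `H`-PACKET (named law)**: a discrete `H`-packet `ρ` whose image e.v.p. slot `evpH ρ = ρ.evpHψ ψ νG` (★ FILE 3h, the e.v.p. of
`ξ_H(ρ) = Π(ρ)`) agrees with the record `t(ξ)` off a finite `S` containing `ramH ρ` IS `ξ = rhoXiS hH ξ` — Thm. 13.3.5 gives `Π(ρ) = Π(ξ)`, and `Π(ρ) = Π(ξ)` with `Π(ξ) ∈ Π_a`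
(disjoint from `Π_e`, p. 202) forces `ρ` one-dimensional with `t(Π(ρ)) = t(Π(ξ))`, whence `ρ = ξ` [p. 243 «there exists a unique `ξ` …»].  A hypothesis of the junction (letter PK-A content).
[cite: Rogawski1990, §13.3 Thm. 13.3.5 p. 202, p. 202 «`Π_a(G)` and `Π_e(G)` are disjoint»; §14.6 (14.6.2) p. 241, (14.6.3) p. 243] -/
def XiRigidityH (hH : XiHPacketsSigned 𝔩 𝔞 𝔞H DiscH Pk PkInf χ hχ ε κH)
    (ψ : ∀ v : HeightOneSpectrum (𝓞 ↥(maximalRealSubfield L)), (cmDatum L 3 H).Local v ≃ₜ* (cmDatum L 3 (splitForm L 3)).Local v)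
    [∀ v : HeightOneSpectrum (𝓞 ↥(maximalRealSubfield L)), MeasurableSpace ((cmDatum L 3 (splitForm L 3)).Local v)]
    (νG : ∀ v : HeightOneSpectrum (𝓞 ↥(maximalRealSubfield L)), Measure ((cmDatum L 3 (splitForm L 3)).Local v))
    (tXi : OneDimAutRepH L → EvpData L H) : Prop :=
  ∀ (ξ : OneDimAutRepH L) (S : Finset (HeightOneSpectrum (𝓞 ↥(maximalRealSubfield L)))) (ρ : SpectralPacketH 𝔩 𝔞 𝔞H DiscH),
    EqOff L H S (ρ.evpHψ ψ νG) (tXi ξ) → ρ.ramFinsetH ⊆ S → ρ = rhoXiS hH ξ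

variable {hH : XiHPacketsSigned 𝔩 𝔞 𝔞H DiscH Pk PkInf χ hχ ε κH}
  {ψ : ∀ v : HeightOneSpectrum (𝓞 ↥(maximalRealSubfield L)), (cmDatum L 3 H).Local v ≃ₜ* (cmDatum L 3 (splitForm L 3)).Local v}
  [∀ v : HeightOneSpectrum (𝓞 ↥(maximalRealSubfield L)), MeasurableSpace ((cmDatum L 3 (splitForm L 3)).Local v)]
  {νG : ∀ v : HeightOneSpectrum (𝓞 ↥(maximalRealSubfield L)), Measure ((cmDatum L 3 (splitForm L 3)).Local v)}
  {tXi : OneDimAutRepH L → EvpData L H}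

/-- **(t3) THE `H`-INDEX TYPE OF (P2) IS `ξ` ALONE**: under (L3), every element of the subtype `{ρ // germ S (evpH ρ) = germ S (t ξ) ∧ ramH ρ ⊆ S}` has first component `rhoXiS hH ξ`.
[cite: Rogawski1990, §13.3 Thm. 13.3.5 p. 202; §14.6 (14.6.3) p. 243] -/
theorem germSubtype_val_eq_rhoXiS (hrig : XiRigidityH hH ψ νG tXi) (ξ : OneDimAutRepH L) (S : Finset (HeightOneSpectrum (𝓞 ↥(maximalRealSubfield L))))
    (ρ : {ρ : SpectralPacketH 𝔩 𝔞 𝔞H DiscH // germ L H S (ρ.evpHψ ψ νG) = germ L H S (tXi ξ) ∧ ρ.ramFinsetH ⊆ S}) : ρ.1 = rhoXiS hH ξ :=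
  hrig ξ S ρ.1 ((germ_eq_germ_iff L H S _ _).1 ρ.2.1) ρ.2.2

/-- **(t4) THE `H`-GERM SUM OF (P2) AT THE TUPLE — «`Σ_{ρ : t(ξ_H(ρ)) = t(ξ) off S, ramH ρ ⊆ S} n(ρ) · Tr ρ_S(f′^H_S) = Tr ξ_S(f′^H_S)`»** [(14.6.3)]: under (L3) rigidity, the (P2a)
facts for `ξ` and the multiplicity value `n(ξ) = 1`, for ANY slots `nH`, `trHS` with `nH (rhoXiS hH ξ) = 1`.
[cite: Rogawski1990, §14.6 (14.6.2) p. 241, (14.6.3) p. 243; §13.3 Thm. 13.3.5, Thm. 13.3.7 pp. 202–203] -/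
theorem tsum_germ_eq_rhoXiS (hrig : XiRigidityH hH ψ νG tXi) (ξ : OneDimAutRepH L) (S : Finset (HeightOneSpectrum (𝓞 ↥(maximalRealSubfield L))))
    (hevpH : EqOff L H S ((rhoXiS hH ξ).evpHψ ψ νG) (tXi ξ)) (hramH : (rhoXiS hH ξ).ramFinsetH ⊆ S)
    (nH : SpectralPacketH 𝔩 𝔞 𝔞H DiscH → ℂ) (hnH : nH (rhoXiS hH ξ) = 1) {X : Type} (trHS : SpectralPacketH 𝔩 𝔞 𝔞H DiscH → X → ℂ) (fSH : X) :
    (∑' ρ : {ρ : SpectralPacketH 𝔩 𝔞 𝔞H DiscH // germ L H S (ρ.evpHψ ψ νG) = germ L H S (tXi ξ) ∧ ρ.ramFinsetH ⊆ S}, nH ρ.1 * trHS ρ.1 fSH)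
      = trHS (rhoXiS hH ξ) fSH := by
  let a : {ρ : SpectralPacketH 𝔩 𝔞 𝔞H DiscH // germ L H S (ρ.evpHψ ψ νG) = germ L H S (tXi ξ) ∧ ρ.ramFinsetH ⊆ S} :=
    ⟨rhoXiS hH ξ, (germ_eq_germ_iff L H S _ _).2 hevpH, hramH⟩
  rw [tsum_eq_single a (fun ρ hρ => absurd (Subtype.ext ((germSubtype_val_eq_rhoXiS hrig ξ S ρ).trans (germSubtype_val_eq_rhoXiS hrig ξ S a).symm)) hρ)]
  change nH (rhoXiS hH ξ) * trHS (rhoXiS hH ξ) fSH = _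
  rw [hnH, one_mul]

end Summit.HodgeConjecture.HodgeConjecture.Cruxes.H413.F0P3SpectralPacket.SpectralPacketH

end
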